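import Mathlib
import Literature.Computability.Complexity.ExtMonotoneGates
import Literature.Computability.Complexity.CliqueApproximatorsWide
import Literature.Computability.Complexity.RossmanMonotoneCliqueProb
import Literature.Computability.Complexity.RossmanMonotoneCliqueGraphs
import Summits.PneNP.PneNP.Theorems.ConvexRankGatesLinAlgGateBlindDefs

/-!
# Stub `stub_pluckingBound` of line `dnf-invariant-wide-gates-see-small-cliques` for crux `LinAlgGateBlind` (stmt-PneNP-10681, route ConvexRankGates)

**Plucking under the product measure.** The `G(m, q)` twin of the tree's
`Literature.Computability.Complexity.card_errNeg_mul_le` (Alon–Boppana 1987, Lemma 3.7 with the step count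
`|𝒱(l)|` of the remark before Lemma 3.4): for a family `𝒞 ⊆ 𝒱(l)` of small vertex sets,

`Pr_{x ∼ G(m,q)} [⌈𝒞*⌉(x) ∧ ¬ ⌈𝒞⌉(x)] ≤ |𝒱(l)| · (1 - q^{C(l,2)})^r`,

where `𝒞* = Razborov.closure r l 𝒞` is the closure in the lattice `K(m, r, l)` and `⌈·⌉ = Accepts`.

Proof (the induction of `card_errNeg_mul_le` with `prob q` in place of counting colourings): closing `𝒞`
adds implied sets `canon U` one at a time (`|𝒱(l) ∖ 𝒞|` steps, closure unchanged by
`closure_eq_of_subset_of_subset_closure`); one addition wrongly accepts a graph `x` only if the clique on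
`canon U` is present while each of the `r` implying members `W₁, …, W_r` (`W_i ∩ W_j ⊆ U`) misses an edge
of its PRIVATE edge set `E(K_{W_i}) ∖ E(K_U)`; these `r` edge sets are pairwise disjoint and of size
`≤ C(l, 2)`, so by independence of disjoint blocks of coordinates under the product measure
(`prob_and_eq_mul_of_dependsOn`, `prob_forall_exists_eq_false`: `Pr[∀ i, some edge of P_i is off] =
∏ᵢ (1 - q^{|P_i|})` for pairwise disjoint `P_i`) the step costs at most `(1 - q^{C(l,2)})^r`
(`prob_badStep_le`).

Sources: N. Alon, R. B. Boppana, Combinatorica 7 (1987), §3.1–3.2, Lemmas 3.6–3.7 [AlonBoppana1987];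
A. A. Razborov, Dokl. Akad. Nauk SSSR 281 (1985) [Razborov1985]; finite product probability [folklore].
-/

-- `Summit.PneNP.PneNP.…` duplicates `PneNP` BY DESIGN (single-problem summit).
set_option linter.dupNamespace false

noncomputable section

namespace Summit.PneNP.PneNP.Cruxes.LinAlgGateBlind.DnfInvariantWideGatesSeeSmallCliques

open scoped BigOperators
open Finset Literature.Computability.Complexity Razborov Literature.Combinatorics.SetFamily

/-! ### Independence of disjoint blocks of coordinates under the product measure -/

section Independence

variable {ι : Type*} [Fintype ι] [DecidableEq ι]

/-- The weight of a Boolean vector is the product of its Bernoulli factors: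
`pw p x = ∏ₑ bern p (x e)`. [folklore] -/
theorem pw_eq_prod_bern (p : ℝ) (x : ι → Bool) : pw p x = ∏ e, bern p (x e) := by
  rw [pw, biasedWeight_eq_prod]
  exact Fintype.prod_congr _ _ fun e => by simp

/-- The weight of a glued vector `S.piecewise x y`: the `S`-factors of `x` times the off-`S` factors
of `y`. [folklore] -/
theorem pw_piecewise (p : ℝ) (S : Finset ι) (x y : ι → Bool) :
    pw p (S.piecewise x y) = (∏ e ∈ S, bern p (x e)) * ∏ e ∈ Sᶜ, bern p (y e) := by
  rw [pw_eq_prod_bern, ← Finset.prod_mul_prod_compl S]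
  congr 1
  · exact Finset.prod_congr rfl fun e he => by rw [Finset.piecewise_eq_of_mem _ _ _ he]
  · exact Finset.prod_congr rfl fun e he => by
      rw [Finset.piecewise_eq_of_notMem _ _ _ (Finset.mem_compl.1 he)]

/-- Total mass of the weights: `∑ₓ pw p x = 1`. [folklore] -/
theorem sum_pw_eq_one (p : ℝ) : ∑ x : ι → Bool, pw p x = 1 := by
  have h := prob_true (ι := ι) p
  rw [prob_eq_sum_ite] at h
  simpa using h

/-- **Independence of disjoint blocks of coordinates.** If the event `A` only looks at the
coordinates in `S` and `B` only at the coordinates outside `S`, then `Pr[A ∧ B] = Pr[A] · Pr[B]` under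
the product measure (proof: reindex the double sum `Pr[A] Pr[B] = ∑_{x,y} …` by the gluing involution
`(x, y) ↦ (S.piecewise x y, S.piecewise y x)`, under which the product weight is invariant). [folklore] -/
theorem prob_and_eq_mul_of_dependsOn (p : ℝ) (S : Finset ι) (A B : (ι → Bool) → Prop)
    (hA : ∀ x y : ι → Bool, (∀ e ∈ S, x e = y e) → (A x ↔ A y))
    (hB : ∀ x y : ι → Bool, (∀ e ∉ S, x e = y e) → (B x ↔ B y)) :
    prob p (fun x => A x ∧ B x) = prob p A * prob p B := by
  classical
  have hinv : Function.Involutive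
      (fun z : (ι → Bool) × (ι → Bool) => (S.piecewise z.1 z.2, S.piecewise z.2 z.1)) := by
    rintro ⟨x, y⟩
    simp only [Finset.piecewise_idem_left, Finset.piecewise_idem_right, Finset.piecewise_same]
  rw [prob_eq_sum_ite, prob_eq_sum_ite, prob_eq_sum_ite, Fintype.sum_mul_sum]
  calc ∑ x : ι → Bool, (if A x ∧ B x then pw p x else 0)
      = ∑ x : ι → Bool, (if A x ∧ B x then pw p x else 0) * ∑ y : ι → Bool, pw p y := by
        simp only [sum_pw_eq_one, mul_one]
    _ = ∑ z : (ι → Bool) × (ι → Bool), (if A z.1 ∧ B z.1 then pw p z.1 else 0) * pw p z.2 := by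
        rw [Fintype.sum_prod_type]
        simp only [Finset.mul_sum]
    _ = ∑ z : (ι → Bool) × (ι → Bool),
          (if A z.1 then pw p z.1 else 0) * (if B z.2 then pw p z.2 else 0) := by
        refine (Fintype.sum_bijective _ hinv.bijective _ _ fun z => ?_).symm
        obtain ⟨x, y⟩ := z
        have hAx : A x ↔ A (S.piecewise x y) :=
          hA _ _ fun e he => (Finset.piecewise_eq_of_mem _ _ _ he).symm
        have hBy : B y ↔ B (S.piecewise x y) :=
          hB _ _ fun e he => (Finset.piecewise_eq_of_notMem _ _ _ he).symm
        have hw : pw p x * pw p y = pw p (S.piecewise x y) * pw p (S.piecewise y x) := by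
          rw [pw_piecewise, pw_piecewise, pw_eq_prod_bern, pw_eq_prod_bern,
            ← Finset.prod_mul_prod_compl S (fun e => bern p (x e)),
            ← Finset.prod_mul_prod_compl S (fun e => bern p (y e))]
          ring
        dsimp only
        by_cases ha : A x
        · by_cases hb : B y
          · rw [if_pos ha, if_pos hb, if_pos ((and_congr hAx hBy).1 ⟨ha, hb⟩), hw]
          · have hn : ¬ (A (S.piecewise x y) ∧ B (S.piecewise x y)) := fun h => hb (hBy.2 h.2)
            simp only [if_neg hb, if_neg hn, mul_zero, zero_mul]
        · have hn : ¬ (A (S.piecewise x y) ∧ B (S.piecewise x y)) := fun h => ha (hAx.2 h.1)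
          simp only [if_neg ha, if_neg hn, zero_mul]
    _ = ∑ x : ι → Bool, ∑ y : ι → Bool, (if A x then pw p x else 0) * (if B y then pw p y else 0) := by
        rw [Fintype.sum_prod_type]

/-- `Pr[some coordinate in P is off] = 1 - p^{|P|}`. [folklore] -/
theorem prob_exists_eq_false (p : ℝ) (P : Finset ι) :
    prob p (fun x : ι → Bool => ∃ e ∈ P, x e = false) = 1 - p ^ #P := by
  rw [← prob_forall_eq_true p P, ← prob_not]
  exact prob_congr fun x => by simp

/-- **Missing coordinates in pairwise disjoint blocks are independent**: for pairwise disjoint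
`P₀, …, P_{r-1}`, `Pr[∀ i, some coordinate in P_i is off] = ∏ᵢ (1 - p^{|P_i|})`. [folklore] -/
theorem prob_forall_exists_eq_false (p : ℝ) :
    ∀ (r : ℕ) (P : Fin r → Finset ι), (∀ i j, i ≠ j → Disjoint (P i) (P j)) →
      prob p (fun x : ι → Bool => ∀ i, ∃ e ∈ P i, x e = false) = ∏ i, (1 - p ^ #(P i)) := by
  intro r
  induction r with
  | zero =>
    intro P _
    rw [Fin.prod_univ_zero, ← prob_true (ι := ι) p]
    exact prob_congr fun x => by simp
  | succ r ih =>
    intro P hP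
    have h0 : ∀ i : Fin r, Disjoint (P i.succ) (P 0) := fun i => hP _ _ (Fin.succ_ne_zero i)
    rw [Fin.prod_univ_succ, ← prob_exists_eq_false p (P 0),
      ← ih (fun i => P i.succ) fun i j hij => hP _ _ fun h => hij (Fin.succ_injective _ h),
      ← prob_and_eq_mul_of_dependsOn p (P 0)]
    · exact prob_congr fun x => Fin.forall_fin_succ
    · intro x y hxy
      exact exists_congr fun e => and_congr_right fun he => by rw [hxy e he]
    · intro x y hxy
      refine forall_congr' fun i => exists_congr fun e => and_congr_right fun he => ?_
      rw [hxy e (Finset.disjoint_left.1 (h0 i) he)]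

end Independence

/-! ### Clique indicators through edge sets; the cost of one closure step -/

variable {m : ℕ}

/-- The potential edges inside `W` are exactly the live edges of `W`. [folklore] -/
theorem mem_edgesIn_iff_isLive (W : Finset (Fin m)) (e : KEdge m) : e ∈ edgesIn W ↔ IsLive W e := by
  simp [edgesIn, IsLive, Finset.subset_iff]

/-- The clique on `W` is present iff every potential edge inside `W` is on. [folklore] -/
theorem cliquePresent_iff_edgesIn (W : Finset (Fin m)) (x : KEdge m → Bool) :
    CliquePresent W x ↔ ∀ e ∈ edgesIn W, x e = true := by
  simp only [CliquePresent, mem_edgesIn_iff_isLive]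

/-- A vertex set with a potential edge inside has at least two vertices. [folklore] -/
theorem two_le_card_of_mem_edgesIn {U : Finset (Fin m)} {e : KEdge m} (he : e ∈ edgesIn U) :
    2 ≤ #U := by
  rw [edgesIn, mem_filter] at he
  calc 2 = #(endpts e) := (card_endpts e).symm
    _ ≤ #U := card_le_card he.2

/-- **The cost of one closure step** (the product-measure form of Alon–Boppana 1987, Lemma 3.6): if
`W₁, …, W_r` imply `U` (`W_i ∩ W_j ⊆ U` for `i ≠ j`) and `|W_i| ≤ l`, then
`Pr_{G(m,q)}[⌈canon U⌉ ∧ ∀ i, ¬⌈W_i⌉] ≤ (1 - q^{C(l,2)})^r`: given the clique on `canon U`, each `W_i`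
misses an edge of its private edge set `E(K_{W_i}) ∖ E(K_U)`; these sets are pairwise disjoint and have
`≤ C(l,2)` edges. [cite: AlonBoppana1987, Lemma 3.6] -/
theorem prob_badStep_le {r l : ℕ} {q : ℝ} (hq0 : 0 ≤ q) (hq1 : q ≤ 1) (U : Finset (Fin m))
    (W : Fin r → Finset (Fin m)) (hWl : ∀ i, #(W i) ≤ l) (hWU : ∀ i j, i ≠ j → W i ∩ W j ⊆ U) :
    prob q (fun x : KEdge m → Bool => CliquePresent (canon U) x ∧ ∀ i, ¬ CliquePresent (W i) x) ≤
      (1 - q ^ (l.choose 2)) ^ r := by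
  classical
  -- the private edge sets
  set Pv : Fin r → Finset (KEdge m) := fun i => edgesIn (W i) \ edgesIn U with hPv
  have hdisj : ∀ i j, i ≠ j → Disjoint (Pv i) (Pv j) := by
    intro i j hij
    rw [Finset.disjoint_left]
    intro e hei hej
    simp only [hPv, mem_sdiff, edgesIn, mem_filter, mem_univ, true_and] at hei hej
    exact hei.2 ((subset_inter hei.1 hej.1).trans (hWU i j hij))
  have hcover : ∀ x : KEdge m → Bool, (CliquePresent (canon U) x ∧ ∀ i, ¬ CliquePresent (W i) x) →
      ∀ i, ∃ e ∈ Pv i, x e = false := by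
    rintro x ⟨hU, hW⟩ i
    by_contra h
    refine hW i ((cliquePresent_iff_edgesIn _ _).2 fun e he => ?_)
    by_cases heU : e ∈ edgesIn U
    · rw [canon_eq_self (two_le_card_of_mem_edgesIn heU)] at hU
      exact (cliquePresent_iff_edgesIn _ _).1 hU e heU
    · by_contra hx
      exact h ⟨e, by simp only [hPv, mem_sdiff]; exact ⟨he, heU⟩, eq_false_of_ne_true hx⟩
  calc prob q (fun x : KEdge m → Bool => CliquePresent (canon U) x ∧ ∀ i, ¬ CliquePresent (W i) x)
      ≤ prob q (fun x : KEdge m → Bool => ∀ i, ∃ e ∈ Pv i, x e = false) := prob_mono hq0 hq1 hcover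
    _ = ∏ i, (1 - q ^ #(Pv i)) := prob_forall_exists_eq_false q r Pv hdisj
    _ ≤ ∏ _i : Fin r, (1 - q ^ (l.choose 2)) := by
        refine Finset.prod_le_prod (fun i _ => sub_nonneg.2 (pow_le_one₀ hq0 hq1)) fun i _ => ?_
        have hcard : #(Pv i) ≤ l.choose 2 :=
          calc #(Pv i) ≤ #(edgesIn (W i)) := card_le_card sdiff_subset
            _ ≤ (#(W i)).choose 2 := card_edgesIn_le _
            _ ≤ l.choose 2 := Nat.choose_le_choose 2 (hWl i)
        exact sub_le_sub_left (pow_le_pow_of_le_one hq0 hq1 hcard) 1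
    _ = (1 - q ^ (l.choose 2)) ^ r := Fin.prod_const r _

/-! ### Plucking: the induction on `|𝒱(l) ∖ 𝒞|` -/

/-- A closed family has no closure error: `Pr[⌈𝒞*⌉ ∧ ¬⌈𝒞⌉] = 0` when `𝒞* = 𝒞`. [folklore] -/
theorem prob_closure_and_not_eq_zero {r l : ℕ} (q : ℝ) {C : Finset (Finset (Fin m))}
    (hcl : IsClosedFamily r l C) :
    prob q (fun x : KEdge m → Bool => Accepts (closure r l C) x ∧ ¬ Accepts C x) = 0 := by
  rw [closure_eq_of_isClosedFamily hcl, ← prob_false (ι := KEdge m) q]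
  exact prob_congr fun x => by simp

/-- **Plucking under the product measure** (registered stub `stub_pluckingBound`; the `G(m,q)` twin of
`card_errNeg_mul_le`, Alon–Boppana 1987, Lemma 3.7 with `|𝒱(l)|` closure steps): for `𝒞 ⊆ 𝒱(l)`,
`Pr_{G(m,q)}[⌈𝒞*⌉ ∧ ¬⌈𝒞⌉] ≤ |𝒱(l)| · (1 - q^{C(l,2)})^r`. Induction on `|𝒱(l) ∖ 𝒞|`: a non-closed `𝒞`
has an implied `U` with `canon U ∉ 𝒞`; inserting it keeps the closure and costs at most
`Pr[⌈canon U⌉ ∧ ∀ i, ¬⌈W_i⌉] ≤ (1 - q^{C(l,2)})^r` (`prob_badStep_le`). [cite: AlonBoppana1987, Lemma 3.7] -/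
theorem stub_pluckingBound :
    ∀ (m r l : ℕ) (q : ℝ), 0 ≤ q → q ≤ 1 → ∀ 𝒞 : Finset (Finset (Fin m)), 𝒞 ⊆ smallSets (Fin m) l →
      prob q (fun x : KEdge m → Bool => Accepts (closure r l 𝒞) x ∧ ¬ Accepts 𝒞 x)
        ≤ (#(smallSets (Fin m) l) : ℝ) * (1 - q ^ (l.choose 2)) ^ r := by
  intro m r l q hq0 hq1 𝒞 h𝒞
  classical
  have hB : 0 ≤ (1 - q ^ (l.choose 2)) ^ r := pow_nonneg (sub_nonneg.2 (pow_le_one₀ hq0 hq1)) r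
  suffices h : ∀ (n : ℕ) (C : Finset (Finset (Fin m))), C ⊆ smallSets (Fin m) l →
      #(smallSets (Fin m) l \ C) = n →
      prob q (fun x : KEdge m → Bool => Accepts (closure r l C) x ∧ ¬ Accepts C x)
        ≤ (n : ℝ) * (1 - q ^ (l.choose 2)) ^ r by
    calc prob q (fun x : KEdge m → Bool => Accepts (closure r l 𝒞) x ∧ ¬ Accepts 𝒞 x)
        ≤ (#(smallSets (Fin m) l \ 𝒞) : ℝ) * (1 - q ^ (l.choose 2)) ^ r := h _ 𝒞 h𝒞 rfl
      _ ≤ (#(smallSets (Fin m) l) : ℝ) * (1 - q ^ (l.choose 2)) ^ r :=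
        mul_le_mul_of_nonneg_right (Nat.cast_le.2 (card_le_card sdiff_subset)) hB
  intro n
  induction n with
  | zero =>
    intro C hC hn
    have hCeq : C = smallSets (Fin m) l :=
      Subset.antisymm hC fun W hW => by
        by_contra hWC
        exact card_ne_zero.2 ⟨W, mem_sdiff.2 ⟨hW, hWC⟩⟩ hn
    rw [prob_closure_and_not_eq_zero q (hCeq ▸ isClosedFamily_smallSets r l), Nat.cast_zero, zero_mul]
  | succ n ih =>
    intro C hC hn
    by_cases hcl : IsClosedFamily r l C
    · rw [prob_closure_and_not_eq_zero q hcl]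
      positivity
    -- an implied set missing from `C`
    have hex : ∃ U : Finset (Fin m), #U ≤ l ∧ Implies r C U ∧ canon U ∉ C := by
      by_contra h
      push Not at h
      exact hcl ⟨hC, h⟩
    obtain ⟨U, hUl, ⟨W, hW, hWU⟩, hUC⟩ := hex
    have hImp : Implies r C U := ⟨W, hW, hWU⟩
    have hcanon : canon U ∈ closure r l C :=
      (isClosedFamily_closure r l C).mem_of_implies U hUl (hImp.mono (subset_closure hC))
    set C' := insert (canon U) C with hC'def
    have hC' : C' ⊆ smallSets (Fin m) l := insert_subset (canon_mem_smallSets hUl) hC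
    have hcleq : closure r l C' = closure r l C :=
      closure_eq_of_subset_of_subset_closure (subset_insert _ _)
        (insert_subset hcanon (subset_closure hC))
    have hn' : #(smallSets (Fin m) l \ C') = n := by
      rw [hC'def, sdiff_insert, card_erase_of_mem (mem_sdiff.2 ⟨canon_mem_smallSets hUl, hUC⟩), hn]
      rfl
    -- the new errors: accepted by `⌈C'⌉` but not by `⌈C⌉` means the clique on `canon U` is present
    have hcover : ∀ x : KEdge m → Bool, (Accepts (closure r l C) x ∧ ¬ Accepts C x) →
        (Accepts (closure r l C') x ∧ ¬ Accepts C' x) ∨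
          (CliquePresent (canon U) x ∧ ∀ i, ¬ CliquePresent (W i) x) := by
      rintro x ⟨hacc, hnacc⟩
      by_cases hC'acc : Accepts C' x
      · refine Or.inr ⟨?_, fun i hP => hnacc ⟨W i, hW i, hP⟩⟩
        obtain ⟨W₀, hW₀, hP⟩ := hC'acc
        rcases mem_insert.1 hW₀ with rfl | hW₀C
        · exact hP
        · exact absurd ⟨W₀, hW₀C, hP⟩ hnacc
      · exact Or.inl ⟨by rwa [hcleq], hC'acc⟩
    have hbad := prob_badStep_le hq0 hq1 U W (fun i => (mem_smallSets.1 (hC (hW i))).1) hWU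
    calc prob q (fun x : KEdge m → Bool => Accepts (closure r l C) x ∧ ¬ Accepts C x)
        ≤ prob q (fun x : KEdge m → Bool => (Accepts (closure r l C') x ∧ ¬ Accepts C' x) ∨
            (CliquePresent (canon U) x ∧ ∀ i, ¬ CliquePresent (W i) x)) := prob_mono hq0 hq1 hcover
      _ ≤ prob q (fun x : KEdge m → Bool => Accepts (closure r l C') x ∧ ¬ Accepts C' x) +
            prob q (fun x : KEdge m → Bool =>
              CliquePresent (canon U) x ∧ ∀ i, ¬ CliquePresent (W i) x) := prob_or_le hq0 hq1 _ _
      _ ≤ (n : ℝ) * (1 - q ^ (l.choose 2)) ^ r + (1 - q ^ (l.choose 2)) ^ r :=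
          add_le_add (ih C' hC' hn') hbad
      _ = ((n + 1 : ℕ) : ℝ) * (1 - q ^ (l.choose 2)) ^ r := by push_cast; ring

end Summit.PneNP.PneNP.Cruxes.LinAlgGateBlind.DnfInvariantWideGatesSeeSmallCliques

end
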